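import Literature.Algebra.Homology.ContCohomologyInflation
import Mathlib.GroupTheory.OrderOfElement
import HarnessLib

/-!
# Degree-one inflation: sufficient conditions for the hypothesis `CrossedHomsKillKer φ X`

J.-P. Serre, *Galois Cohomology*, I §2.6 (b) (inflation–restriction in degree one) and I §2.3
(`H¹` = classes of continuous crossed homomorphisms) [cite: SerreGaloisCohomology1997, I §2.6 (b)].

PROOF-ONLY companion of `ContCohomologyInflation.lean` (abc-iut cell, FACT-LIST row **F-2284**
`ContinuousCohomology.CrossedHomsKillKer`, class `classical/other`; its universal closure is refuted in
`ContCohomologyInflationSchemaNegative.lean`, so the row lives through its INSTANCE forms).  This file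
records the textbook instance forms, i.e. the standard reasons why the restriction term
`H¹(Ker φ, X)^{G}` of the inflation–restriction sequence vanishes:

* the restriction of a continuous crossed homomorphism `f : H → X` (action through `φ : H → G`) to
  `Ker φ` is an ordinary homomorphism (`crossedHom_apply_mul_of_map_eq_one`, `…_pow_…`, `…_inv_…`),
  `φ`-equivariant under conjugation (`crossedHom_apply_conj_of_map_eq_one`), and `f 1 = 0`;
* `crossedHomsKillKer_of_injective` — trivial kernel;
* `crossedHomsKillKer_of_isOfFinOrder` — every element of `Ker φ` has finite order and `X` has no
  additive torsion (e.g. a finite normal subgroup acting on a `ℤ_ℓ`-lattice);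
* `crossedHomsKillKer_of_isCompact_of_discrete` — `Ker φ` is compact and `X` is discrete without
  additive torsion (a compact group has no non-trivial continuous homomorphism to such an `X`);
* `crossedHomsKillKer_of_forall_hom_eq_zero` — the general form: every continuous homomorphism
  `Ker φ → X` (for the trivial action) that is `φ`-equivariant vanishes.

Theorems only, elementary; nothing here bears on the disputed [IUTchIII] Cor. 3.12 or takes a side.
-/

namespace ContinuousCohomology

open ContRepresentation Topology

universe u v w

variable {k : Type u} [Ring k] [TopologicalSpace k]
variable {G H : Type v} [Group G] [TopologicalSpace G] [IsTopologicalGroup G]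
  [Group H] [TopologicalSpace H] [IsTopologicalGroup H]
variable {φ : H →ₜ* G} {X : TopRep.{max v w} k G}

/-! ### A continuous crossed homomorphism restricted to `Ker φ` -/

section CrossedHom

variable {f : C(H, X)}

omit [IsTopologicalGroup G] [IsTopologicalGroup H] in
/-- A crossed homomorphism vanishes at `1`. [cite: SerreGaloisCohomology1997, I §2.3] -/
theorem crossedHom_apply_one (hf : ∀ a b, f (a * b) = f a + X.ρ (φ a) (f b)) : f 1 = 0 := by
  have h := hf 1 1
  rw [mul_one, map_one φ, map_one X.ρ, one_apply_eq_self] at h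
  simpa using h

omit [IsTopologicalGroup G] [IsTopologicalGroup H] in
/-- On the kernel of `φ` a crossed homomorphism is additive in its first argument:
`f (n m) = f n + f m` whenever `φ n = 1`. [cite: SerreGaloisCohomology1997, I §2.6 (b)] -/
theorem crossedHom_apply_mul_of_map_eq_one (hf : ∀ a b, f (a * b) = f a + X.ρ (φ a) (f b))
    {n : H} (hn : φ n = 1) (m : H) : f (n * m) = f n + f m := by
  rw [hf, hn, map_one X.ρ, one_apply_eq_self]

omit [IsTopologicalGroup G] [IsTopologicalGroup H] in
/-- On the kernel of `φ`: `f n⁻¹ = - f n`. [cite: SerreGaloisCohomology1997, I §2.6 (b)] -/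
theorem crossedHom_apply_inv_of_map_eq_one (hf : ∀ a b, f (a * b) = f a + X.ρ (φ a) (f b))
    {n : H} (hn : φ n = 1) : f n⁻¹ = -f n := by
  have h := crossedHom_apply_mul_of_map_eq_one hf hn n⁻¹
  rw [mul_inv_cancel, crossedHom_apply_one hf] at h
  rw [eq_neg_iff_add_eq_zero, add_comm]
  exact h.symm

omit [IsTopologicalGroup G] [IsTopologicalGroup H] in
/-- On the kernel of `φ`: `f (n ^ j) = j • f n`. [cite: SerreGaloisCohomology1997, I §2.6 (b)] -/
theorem crossedHom_apply_pow_of_map_eq_one (hf : ∀ a b, f (a * b) = f a + X.ρ (φ a) (f b))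
    {n : H} (hn : φ n = 1) (j : ℕ) : f (n ^ j) = j • f n := by
  induction j with
  | zero => rw [pow_zero, zero_smul, crossedHom_apply_one hf]
  | succ j ih =>
    rw [pow_succ', crossedHom_apply_mul_of_map_eq_one hf hn, ih, succ_nsmul']

omit [IsTopologicalGroup G] [IsTopologicalGroup H] in
/-- The restriction of a crossed homomorphism to `Ker φ` is `φ`-EQUIVARIANT for the conjugation
action: `f (h n h⁻¹) = φ(h) • f n` for `φ n = 1` (so it lands in `Hom(Ker φ, X)^{G}`, the restriction
term of the inflation–restriction sequence). [cite: SerreGaloisCohomology1997, I §2.6 (b)] -/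
theorem crossedHom_apply_conj_of_map_eq_one (hf : ∀ a b, f (a * b) = f a + X.ρ (φ a) (f b))
    {n : H} (hn : φ n = 1) (h : H) : f (h * n * h⁻¹) = X.ρ (φ h) (f n) := by
  have h1 : f h + X.ρ (φ h) (f h⁻¹) = 0 := by
    rw [← hf, mul_inv_cancel, crossedHom_apply_one hf]
  rw [mul_assoc, hf, hf n, hn, map_one X.ρ, one_apply_eq_self, map_add, add_left_comm, h1,
    add_zero]

end CrossedHom

/-! ### Sufficient conditions for `CrossedHomsKillKer φ X` -/

omit [IsTopologicalGroup G] [IsTopologicalGroup H] in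
/-- **General form.** If every continuous map `g : H → X` which is a homomorphism on `Ker φ`
(`g (n m) = g n + g m` for `φ n = 1`), vanishes at `1` and is `φ`-equivariant under conjugation on
`Ker φ` vanishes on `Ker φ`, then `CrossedHomsKillKer φ X` — the restriction term
`Hom_cont(Ker φ, X)^{G} = 0` kills the obstruction. [cite: SerreGaloisCohomology1997, I §2.6 (b)] -/
theorem crossedHomsKillKer_of_forall_hom_eq_zero
    (h : ∀ g : C(H, X), g 1 = 0 → (∀ n m : H, φ n = 1 → g (n * m) = g n + g m) →
      (∀ n h : H, φ n = 1 → g (h * n * h⁻¹) = X.ρ (φ h) (g n)) → ∀ n, φ n = 1 → g n = 0) :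
    CrossedHomsKillKer φ X := fun f hf =>
  h f (crossedHom_apply_one hf) (fun _ m hn => crossedHom_apply_mul_of_map_eq_one hf hn m)
    (fun _ h hn => crossedHom_apply_conj_of_map_eq_one hf hn h)

omit [IsTopologicalGroup G] [IsTopologicalGroup H] in
/-- **Trivial kernel.** If `φ` is injective, every crossed homomorphism kills `Ker φ = 1`.
[cite: SerreGaloisCohomology1997, I §2.6 (b)] -/
theorem crossedHomsKillKer_of_injective (hφ : Function.Injective φ) : CrossedHomsKillKer φ X := by
  intro f hf n hn
  obtain rfl : n = 1 := hφ (by rw [hn, map_one])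
  exact crossedHom_apply_one hf

omit [IsTopologicalGroup G] [IsTopologicalGroup H] in
/-- **Torsion kernel, torsion-free coefficients.** If every element of `Ker φ` has finite order and
`X` has no additive torsion (`j • x = 0`, `0 < j` forces `x = 0`), then `CrossedHomsKillKer φ X`:
on `Ker φ` a crossed homomorphism is a homomorphism, so `j • f n = f (n ^ j) = f 1 = 0`.
[cite: SerreGaloisCohomology1997, I §2.6 (b)] -/
theorem crossedHomsKillKer_of_isOfFinOrder (htor : ∀ n : H, φ n = 1 → IsOfFinOrder n)
    (hX : ∀ (j : ℕ) (x : X), 0 < j → j • x = 0 → x = 0) : CrossedHomsKillKer φ X := by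
  intro f hf n hn
  obtain ⟨j, hj, hnj⟩ := (isOfFinOrder_iff_pow_eq_one).1 (htor n hn)
  refine hX j (f n) hj ?_
  rw [← crossedHom_apply_pow_of_map_eq_one hf hn, hnj, crossedHom_apply_one hf]

omit [IsTopologicalGroup G] [IsTopologicalGroup H] in
/-- **Compact kernel, discrete torsion-free coefficients.** If `Ker φ` is compact and `X` is discrete
without additive torsion, then `CrossedHomsKillKer φ X`: the image `f(Ker φ)` is compact, hence
finite, so the multiples `j • f n = f (n ^ j)` of `f n` repeat and `f n` is a torsion element.
[cite: SerreGaloisCohomology1997, I §2.6 (b)] -/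
theorem crossedHomsKillKer_of_isCompact_of_discrete [DiscreteTopology X]
    (hK : IsCompact {n : H | φ n = 1}) (hX : ∀ (j : ℕ) (x : X), 0 < j → j • x = 0 → x = 0) :
    CrossedHomsKillKer φ X := by
  intro f hf n hn
  -- the image of the kernel is finite
  have hfin : (f '' {n : H | φ n = 1}).Finite := (hK.image f.continuous).finite_of_discrete
  -- all multiples `j • f n` lie in it
  have hmem : ∀ j : ℕ, j • f n ∈ f '' {n : H | φ n = 1} := fun j =>
    ⟨n ^ j, by rw [Set.mem_setOf_eq, map_pow, hn, one_pow], crossedHom_apply_pow_of_map_eq_one hf hn j⟩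
  -- so two of them coincide
  haveI : Finite (f '' {n : H | φ n = 1}) := hfin.to_subtype
  obtain ⟨i, j, hij, hfij⟩ := Finite.exists_ne_map_eq_of_infinite
    (fun j : ℕ => (⟨j • f n, hmem j⟩ : f '' {n : H | φ n = 1}))
  have hfij' : i • f n = j • f n := congrArg Subtype.val hfij
  rcases lt_or_gt_of_ne hij with hlt | hlt
  · refine hX (j - i) (f n) (Nat.sub_pos_of_lt hlt) ?_
    rw [sub_nsmul _ hlt.le, ← sub_eq_add_neg, ← hfij', sub_self]
  · refine hX (i - j) (f n) (Nat.sub_pos_of_lt hlt) ?_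
    rw [sub_nsmul _ hlt.le, ← sub_eq_add_neg, hfij', sub_self]

end ContinuousCohomology
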